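import Summits.QuantumFields.YangMills.Theorems.F4SubCurvatureDoorShellSeparationWindowKernel
import Mathlib
import HarnessLib

/-!
# LINES g21-A «shell separation» / g21-B «fibre dichotomy» (⟨stmt-QuantumFields-23125⟩ `F4SubCurvatureDoor.RationalToGeneral`) —
# registered stub S2 `stub_shellSeparation : ShellSeparation`, BY NAME AND SIGNATURE

Skeletons `Cruxes/RationalToGeneral/Lines/fibre_dichotomy.lean` (:135–138, :170) and `Lines/shell_separation.lean` (shared stub, served once).
The Prop `ShellSeparation` is restated CHARACTER-IDENTICALLY (vocabulary: `InClass`, `IsLF`, `E4`, `E3` from `…LaplaceFourierRegistered`;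
`massSq` = the verbatim copy in ns `…ShellLFAnalytic`; `ShellSeparated`/`InClass₀` = the verbatim copies of the landed stub B5 in ns
`…FibreReductionRegistered`) and PROVED:

`stub_shellSeparation : ShellSeparation` — no deep space-like mass ⇒ every mass multiplier of the Laplace–Fourier measure of a class kernel is
again a budget-free class kernel.

ASSEMBLY (all inputs are tree theorems): (1) `K` is real-analytic off the origin (✓`stub_mirrorAnalyticity`); (2) the iterated shifted Laplacian
`(Δ + Q₀)^k K` is the Laplace–Fourier integral weighted by `(massSq + Q₀)^k` off the mirror (✓`shiftedLaplacian_iterate_eq`, all orders, from the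
weighted line-derivative calculus ✓`…WeightedLines`) and is `D₄`-invariant since `Δ` commutes with linear isometries; (3)–(4) the signed density
`e^{−|(Rx)₀|E}cos⟪q⃗,(Rx)⃗⟫ − e^{−|x₀|E}cos⟪q⃗,x⃗⟫` has vanishing shifted-mass moments, hence vanishing mass-window integrals by the Stieltjes
determinacy R-S2c ✓`oneSidedDeterminacy_holds` (push-forward along `massSq + Q₀ ≥ 0`, `e^{c√λ}`-moments) ⇒ every window measure is
LF-symmetric (✓`symmetricLF_window`); (5) its mirror patch (construction of R-B4e ✓`MirrorPatching`) is a budget-free class kernel with that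
window measure as Laplace–Fourier measure (✓`window_classKernel`).

Mathlib + tree only; no `sorry`; standard axioms.  HONEST LABEL: this closes the shared registered stub S2 of the OPEN lines g21-A/g21-B; with
B4 ✓p724005 and B5 ✓p725139 LINE g21-B now rests on S1 `stub_forwardConeSupport` (XL, the 4D spectral cone) ALONE; the crux ⟨23125⟩, its parent
⟨23035⟩, rung R2d and the Yang–Mills mass gap remain OPEN; no summit is proved by a line.  Seat `ym-line-frs-p2` g16 (cell ym-idea-3, free hands).
-/

noncomputable section

open MeasureTheory Set

namespace Summit.QuantumFields.YangMills.Theorems.F4SubCurvatureDoorShellSeparationRegistered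

open Summit.QuantumFields.YangMills.Theorems.F4SubCurvatureDoorLaplaceFourierRegistered (E4 E3 InClass IsLF)
open Summit.QuantumFields.YangMills.Theorems.F4SubCurvatureDoorShellLFAnalytic (massSq)
open Summit.QuantumFields.YangMills.Theorems.F4SubCurvatureDoorFibreReductionRegistered (InClass₀ ShellSeparated)
open Summit.QuantumFields.YangMills.Theorems.F4SubCurvatureDoorShellSeparationProof (window_classKernel)

/-! ## The registered text (verbatim from `Lines/fibre_dichotomy.lean`) -/

/-- Stub S2 «SHELL SEPARATION» (M–L; verbatim from g21-A — shared, served once). -/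
def ShellSeparation : Prop :=
  ∀ K : E4 → ℝ, InClass K → ∀ μ : Measure (ℝ × E3), IsLF K μ →
    ∀ Q₀ : ℝ, μ {p | massSq p < -Q₀} = 0 → ShellSeparated μ

/-! ## The proof -/

/-- **REGISTERED STUB S2 `stub_shellSeparation` OF LINES g21-A/g21-B, BY NAME AND SIGNATURE: `ShellSeparation` holds.** -/
theorem stub_shellSeparation : ShellSeparation :=
  fun K hK _μ hLF _Q₀ hQ _S hS => window_classKernel K hK hLF hQ hS

end Summit.QuantumFields.YangMills.Theorems.F4SubCurvatureDoorShellSeparationRegistered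

end
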